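import Mathlib
import Summits.ResolutionOfSingularities.ResolutionOfSingularities.Theorems.WildQuotientsWildQuotientResolutionPthConeFanEngine

/-!
# The end vertex charts `D₊(x_ρ^{p(p−1)} t)` of the toric fan blow-up are affine spaces
(crux stmt-ResolutionOfSingularities-15640 `WildQuotients.WildQuotientResolution`, line `Sketch`;
chain w45c POST-V5 S2 = conductor-𝟙 core `ConductorOneCore p n`, brick F6 `…ConductorOneToricFan` =
toric brick `T(a,b)` of res-L1-w45c-lead-1's `S2-DESIGN.md` §3 / §7 (7.6). [OURS · L1 W4.5c] — NOT a
statement of any manuscript; replaces the role of no printed item. Owner res-L1-w45c-stub-4 (gen 5).)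

Instance ONE of the engine `PthCone.isRegularRing_chartRing_of_dualBasis` (…PthConeFanEngine): the cone
`⟨v_1, 𝐞_l (l ∈ S∖ρ), 𝐞_{l'} (l' ∈ T)⟩` of the fan `Σ_{a,b}` at the END VERTEX `x_ρ^{p(p−1)}` (`ρ ∈ S`),
for a partition `S ⊔ T` of the variables carrying weights `±1` up to a common sign — used with
`(S,T) = (A, Aᶜ)` (the `A`-end) AND `(S,T) = (Aᶜ, A)` (the `Aᶜ`-end). Dual basis:
`ε_ρ = p𝐞_ρ` (edge generator `x_ρ^{p²}`, functional `Λ_ρ = Σ_S + (p−1)Σ_T = p⟨v_1,·⟩`),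
`ε_l = 𝐞_l − 𝐞_ρ` (`l ∈ S∖ρ`, edge `x_ρ^{p(p−1)−1}x_l`), `ε_{l'} = 𝐞_{l'} − (p−1)𝐞_ρ` (`l' ∈ T`, edge
`x_ρ^{(p−1)²}x_{l'}`), `Λ_l = p·(l-th coordinate)` otherwise; the chart ring is
`k[x_ρ^p, x_l/x_ρ (l ∈ S∖ρ), x_{l'}/x_ρ^{p−1} (l' ∈ T)]`. The statement is generic in the monomial
family `c` (hypotheses: the four kinds of generators occur in `c`, and every generator `x^d` has
`Σ_S d + (p−1)Σ_T d ≥ p(p−1)`), so that it applies to `PthCone.fanFamily` at both ends. No notation.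
-/

set_option linter.dupNamespace false

noncomputable section

open MvPolynomial
open Literature.AlgebraicGeometry.Resolution

namespace Summit.ResolutionOfSingularities.ResolutionOfSingularities.Theorems.WildQuotientResolution.PthCone

universe u

variable (k : Type) [Field k] (n p : ℕ) (w : Fin n → ZMod p)

/-- Splitting a sum over all variables along a partition `S ⊔ T`. [folklore] -/
theorem sum_univ_eq_of_partition (S T : Finset (Fin n)) (hST : ∀ l, l ∈ S ∨ l ∈ T)
    (hdisj : ∀ l, ¬(l ∈ S ∧ l ∈ T)) (f : Fin n → ℤ) :
    ∑ l, f l = ∑ l ∈ S, f l + ∑ l ∈ T, f l := by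
  classical
  have hU : (Finset.univ : Finset (Fin n)) = S ∪ T := by
    ext l; simpa using hST l
  rw [hU, Finset.sum_union (Finset.disjoint_left.mpr fun l hS hT => hdisj l ⟨hS, hT⟩)]

/-- Splitting a sum over all variables but `ρ ∈ S` along a partition `S ⊔ T`. [folklore] -/
theorem sum_erase_eq_of_partition (S T : Finset (Fin n)) (hST : ∀ l, l ∈ S ∨ l ∈ T)
    (hdisj : ∀ l, ¬(l ∈ S ∧ l ∈ T)) (ρ : Fin n) (hρ : ρ ∈ S) (f : Fin n → ℤ) :
    ∑ l ∈ Finset.univ.erase ρ, f l = ∑ l ∈ S.erase ρ, f l + ∑ l ∈ T, f l := by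
  classical
  have h1 := Finset.add_sum_erase Finset.univ f (Finset.mem_univ ρ)
  have h2 := Finset.add_sum_erase S f hρ
  have h3 := sum_univ_eq_of_partition n S T hST hdisj f
  linarith

-- the proof instantiates the symbolic engine; many case distinctions on the variables
set_option maxHeartbeats 1600000 in
/-- **The end vertex chart is an affine space.** Let `𝔞 = (c_0,…,c_{N−1})` be a monomial ideal of the
cone `(1/p)(w)`, `S ⊔ T` a partition of the variables with `p ∣ Σ_S d − Σ_T d` for every weight-`0`
exponent `d`, `ρ ∈ S`, `c_j = x_ρ^{p(p−1)}`, and suppose `x_ρ^{p²}`, `x_ρ^{p(p−1)−1}x_l` (`l ∈ S∖ρ`),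
`x_ρ^{(p−1)²}x_{l'}` (`l' ∈ T`) occur among the `c_i`, all of which are monomials `x^d` with
`Σ_S d + (p−1)Σ_T d ≥ p(p−1)`. Then the chart ring `(cone[𝔞t])_{(c_j t)}` is regular (a polynomial ring).
[OURS · L1 W4.5c] -/
theorem isRegularRing_chartRing_endVertex {N : ℕ} (c : Fin N → cone k n p w) (j : Fin N) (hp : 2 ≤ p)
    (S T : Finset (Fin n)) (hST : ∀ l, l ∈ S ∨ l ∈ T) (hdisj : ∀ l, ¬(l ∈ S ∧ l ∈ T))
    (hdivw : ∀ d : Fin n →₀ ℕ, Finsupp.weight w d = 0 →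
      (p : ℤ) ∣ (∑ l ∈ S, (d l : ℤ)) - ∑ l ∈ T, (d l : ℤ))
    (ρ : Fin n) (hρ : ρ ∈ S)
    (hcj : ((c j : cone k n p w) : MvPolynomial (Fin n) k) = monomial (Finsupp.single ρ (p * (p - 1))) 1)
    (iq : Fin N) (hiq : ((c iq : cone k n p w) : MvPolynomial (Fin n) k) = monomial (Finsupp.single ρ (p ^ 2)) 1)
    (ie : Fin n → Fin N) (hie : ∀ l ∈ S, l ≠ ρ → ((c (ie l) : cone k n p w) : MvPolynomial (Fin n) k) =
      monomial (Finsupp.single ρ (p * (p - 1) - 1) + Finsupp.single l 1) 1)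
    (ix : Fin n → Fin N) (hix : ∀ l ∈ T, ((c (ix l) : cone k n p w) : MvPolynomial (Fin n) k) =
      monomial (Finsupp.single ρ ((p - 1) ^ 2) + Finsupp.single l 1) 1)
    (hgen : ∀ i : Fin N, ∃ d : Fin n →₀ ℕ, ((c i : cone k n p w) : MvPolynomial (Fin n) k) = monomial d 1 ∧
      (p : ℤ) * (p - 1) ≤ (∑ l ∈ S, (d l : ℤ)) + (p - 1) * ∑ l ∈ T, (d l : ℤ)) :
    IsRegularRing (chartRing c j) := by
  classical
  -- basic facts about the partition
  have hρT : ρ ∉ T := fun h => hdisj ρ ⟨hρ, h⟩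
  have hTne : ∀ l ∈ T, l ≠ ρ := fun l hl h => hρT (h ▸ hl)
  have hSn : ∀ l ∈ S, l ∉ T := fun l hl h => hdisj l ⟨hl, h⟩
  have hTn : ∀ l ∈ T, l ∉ S := fun l hl h => hdisj l ⟨h, hl⟩
  have hp1 : 1 ≤ p := by omega
  have hpp : 1 ≤ p * (p - 1) := Nat.one_le_iff_ne_zero.mpr (Nat.mul_ne_zero (by omega) (by omega))
  have cast1 : ((p - 1 : ℕ) : ℤ) = (p : ℤ) - 1 := by rw [Nat.cast_sub hp1, Nat.cast_one]
  have castpp : ((p * (p - 1) : ℕ) : ℤ) = (p : ℤ) * (p - 1) := by rw [Nat.cast_mul, cast1]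
  have castpp1 : ((p * (p - 1) - 1 : ℕ) : ℤ) = (p : ℤ) * (p - 1) - 1 := by
    rw [Nat.cast_sub hpp, castpp, Nat.cast_one]
  have castsq : (((p - 1) ^ 2 : ℕ) : ℤ) = ((p : ℤ) - 1) ^ 2 := by rw [Nat.cast_pow, cast1]
  -- the weight of an `S`-variable is `1`, of a `T`-variable `p − 1`, relative to `ρ`
  let κ : Fin n → ℤ := fun l => if l ∈ S then 1 else (p : ℤ) - 1
  have hκS : ∀ l ∈ S, κ l = 1 := fun l hl => by simp [κ, hl]
  have hκT : ∀ l ∈ T, κ l = (p : ℤ) - 1 := fun l hl => by simp [κ, hTn l hl]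
  -- the scaled ray functionals
  let Λ : Fin n → ((Fin n → ℤ) →+ ℤ) := fun l =>
    AddMonoidHom.mk' (fun m => if l = ρ then (∑ i ∈ S, m i) + ((p : ℤ) - 1) * ∑ i ∈ T, m i
      else (p : ℤ) * m l) (by
        intro m m'
        by_cases h : l = ρ
        · simp only [if_pos h, Pi.add_apply, Finset.sum_add_distrib]; ring
        · simp only [if_neg h, Pi.add_apply]; ring)
  have hΛρ : ∀ m : Fin n → ℤ, Λ ρ m = (∑ i ∈ S, m i) + ((p : ℤ) - 1) * ∑ i ∈ T, m i := fun m => by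
    simp [Λ]
  have hΛl : ∀ l, l ≠ ρ → ∀ m : Fin n → ℤ, Λ l m = (p : ℤ) * m l := fun l hl m => by
    simp [Λ, hl]
  -- the dual vectors
  let ε : Fin n → Fin n → ℤ := fun l i =>
    if l = ρ then (if i = ρ then (p : ℤ) else 0) else (if i = l then 1 else 0) - κ l * (if i = ρ then 1 else 0)
  have hερ : ∀ i, ε ρ i = if i = ρ then (p : ℤ) else 0 := fun i => by simp [ε]
  have hεl : ∀ l, l ≠ ρ → ∀ i, ε l i = (if i = l then 1 else 0) - κ l * (if i = ρ then 1 else 0) :=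
    fun l hl i => by simp [ε, hl]
  -- useful evaluation: `Λ_ρ(m) = m_ρ + Σ_{l ≠ ρ} κ_l m_l`
  have hΛρ' : ∀ m : Fin n → ℤ, Λ ρ m = m ρ + ∑ l ∈ Finset.univ.erase ρ, κ l * m l := by
    intro m
    rw [hΛρ, sum_erase_eq_of_partition n S T hST hdisj ρ hρ, ← Finset.add_sum_erase S m hρ,
      Finset.sum_congr rfl (fun l hl => by rw [hκS l (Finset.mem_of_mem_erase hl), one_mul] :
        ∀ l ∈ S.erase ρ, κ l * m l = m l),
      Finset.sum_congr rfl (fun l hl => by rw [hκT l hl] : ∀ l ∈ T, κ l * m l = ((p : ℤ) - 1) * m l),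
      ← Finset.mul_sum]
    ring
  refine isRegularRing_chartRing_of_dualBasis k n p w c j (by omega) (Finsupp.single ρ (p * (p - 1))) hcj
    Λ ε ?_ ?_ ?_ ?_
    (fun l => if l = ρ then iq else if l ∈ S then ie l else ix l)
    (fun l => if l = ρ then Finsupp.single ρ (p ^ 2) else if l ∈ S then
      Finsupp.single ρ (p * (p - 1) - 1) + Finsupp.single l 1 else
      Finsupp.single ρ ((p - 1) ^ 2) + Finsupp.single l 1) ?_ ?_ ?_
  · -- duality `p m_i = Σ_l Λ_l(m) ε_l(i)`
    intro m i
    rw [← Finset.add_sum_erase Finset.univ _ (Finset.mem_univ ρ), hερ]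
    have hrest : ∀ l ∈ Finset.univ.erase ρ, Λ l m * ε l i =
        (p : ℤ) * m l * ((if i = l then 1 else 0) - κ l * (if i = ρ then 1 else 0)) := by
      intro l hl
      rw [hΛl l (Finset.ne_of_mem_erase hl), hεl l (Finset.ne_of_mem_erase hl)]
    rw [Finset.sum_congr rfl hrest]
    by_cases hi : i = ρ
    · rw [if_pos hi]
      have hz : ∀ l ∈ Finset.univ.erase ρ,
          (p : ℤ) * m l * ((if i = l then 1 else 0) - κ l * (if i = ρ then 1 else 0)) =
            -((p : ℤ) * (κ l * m l)) := by
        intro l hl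
        rw [if_pos hi, if_neg (fun h : i = l => Finset.ne_of_mem_erase hl (by rw [← h, hi]))]
        ring
      rw [Finset.sum_congr rfl hz, Finset.sum_neg_distrib, ← Finset.mul_sum, hΛρ', hi]
      ring
    · have hz : ∀ l ∈ Finset.univ.erase ρ,
          (p : ℤ) * m l * ((if i = l then 1 else 0) - κ l * (if i = ρ then 1 else 0)) =
            if i = l then (p : ℤ) * m l else 0 := by
        intro l hl
        rw [if_neg hi, mul_zero, sub_zero, mul_ite, mul_one, mul_zero]
      rw [Finset.sum_congr rfl hz, if_neg hi, mul_zero, zero_add, Finset.sum_ite_eq,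
        if_pos (Finset.mem_erase.mpr ⟨hi, Finset.mem_univ _⟩)]
  · -- biorthogonality
    intro l l'
    by_cases hl' : l' = ρ
    · rw [hl', hΛρ]
      by_cases hl : l = ρ
      · rw [hl, if_pos rfl]
        simp only [hερ]
        rw [Finset.sum_ite_eq' S ρ, if_pos hρ, Finset.sum_ite_eq' T ρ, if_neg hρT]
        ring
      · rw [if_neg hl]
        simp only [hεl l hl, Finset.sum_sub_distrib, ← Finset.mul_sum]
        rw [Finset.sum_ite_eq' S l, Finset.sum_ite_eq' T l, Finset.sum_ite_eq' S ρ,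
          Finset.sum_ite_eq' T ρ, if_pos hρ, if_neg hρT]
        rcases hST l with hS | hT
        · rw [if_pos hS, if_neg (hSn l hS), hκS l hS]; ring
        · rw [if_neg (hTn l hT), if_pos hT, hκT l hT]; ring
    · rw [hΛl l' hl']
      by_cases hl : l = ρ
      · rw [hl, hερ, if_neg hl', if_neg (Ne.symm hl'), mul_zero]
      · rw [hεl l hl, if_neg hl', mul_zero, sub_zero]
        by_cases hll : l = l'
        · rw [hll, if_pos rfl, if_pos rfl, mul_one]
        · rw [if_neg (Ne.symm hll), if_neg hll, mul_zero]
  · -- divisibility on weight-`0` exponents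
    intro d hd l
    by_cases hl : l = ρ
    · rw [hl, hΛρ]
      have h := hdivw d hd
      have : (∑ i ∈ S, (d i : ℤ)) + ((p : ℤ) - 1) * ∑ i ∈ T, (d i : ℤ) =
          ((∑ i ∈ S, (d i : ℤ)) - ∑ i ∈ T, (d i : ℤ)) + (p : ℤ) * ∑ i ∈ T, (d i : ℤ) := by ring
      rw [this]
      exact dvd_add h (dvd_mul_right _ _)
    · rw [hΛl l hl]
      exact dvd_mul_right _ _
  · -- non-negativity
    intro d l
    by_cases hl : l = ρ
    · rw [hl, hΛρ]
      have h1 : 0 ≤ ∑ i ∈ S, ((d i : ℕ) : ℤ) := Finset.sum_nonneg fun i _ => by positivity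
      have h2 : 0 ≤ ∑ i ∈ T, ((d i : ℕ) : ℤ) := Finset.sum_nonneg fun i _ => by positivity
      have h3 : (0 : ℤ) ≤ (p : ℤ) - 1 := by linarith [show (2 : ℤ) ≤ p by exact_mod_cast hp]
      positivity
    · rw [hΛl l hl]; positivity
  · -- the edge generators occur in the family
    intro l
    by_cases hl : l = ρ
    · rw [hl, if_pos rfl, if_pos rfl]; exact hiq
    · rcases hST l with hS | hT
      · simp only [if_neg hl, if_pos hS]; exact hie l hS hl
      · simp only [if_neg hl, if_neg (hTn l hT)]; exact hix l hT
  · -- edge exponents `= m_τ + ε_l`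
    have hsingle : ∀ (a : Fin n) (b : ℕ) (i : Fin n),
        ((Finsupp.single a b i : ℕ) : ℤ) = if i = a then (b : ℤ) else 0 := by
      intro a b i
      rw [Finsupp.single_apply]
      by_cases h : i = a
      · rw [if_pos h.symm, if_pos h]
      · rw [if_neg (Ne.symm h), if_neg h, Nat.cast_zero]
    intro l i
    by_cases hl : l = ρ
    · rw [hl, if_pos rfl, hερ, hsingle, hsingle]
      by_cases hi : i = ρ
      · rw [if_pos hi, if_pos hi, if_pos hi, castpp]; push_cast; ring
      · rw [if_neg hi, if_neg hi, if_neg hi]; ring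
    · rw [hεl l hl]
      rcases hST l with hS | hT
      · rw [if_neg hl, if_pos hS, Finsupp.coe_add, Pi.add_apply, Nat.cast_add, hsingle, hsingle, hsingle,
          hκS l hS]
        by_cases hi : i = ρ
        · have hne : ¬i = l := fun h => hl (h.symm.trans hi)
          rw [if_pos hi, if_pos hi, if_pos hi, if_neg hne, if_neg hne, castpp, castpp1]
          push_cast; ring
        · rw [if_neg hi, if_neg hi, if_neg hi]
          by_cases hil : i = l
          · simp [if_pos hil]
          · simp [if_neg hil]
      · rw [if_neg hl, if_neg (hTn l hT), Finsupp.coe_add, Pi.add_apply, Nat.cast_add, hsingle, hsingle,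
          hsingle, hκT l hT]
        by_cases hi : i = ρ
        · have hne : ¬i = l := fun h => hl (h.symm.trans hi)
          rw [if_pos hi, if_pos hi, if_pos hi, if_neg hne, if_neg hne, castpp, castsq]
          ring
        · rw [if_neg hi, if_neg hi, if_neg hi]
          by_cases hil : i = l
          · simp [if_pos hil]
          · simp [if_neg hil]
  · -- every generator lies on the right side of the facets through the vertex
    intro i
    obtain ⟨d, hd, hle⟩ := hgen i
    refine ⟨d, hd, fun l => ?_⟩
    by_cases hl : l = ρ
    · rw [hl, hΛρ, hΛρ]
      simp only [Finsupp.single_apply, Nat.cast_ite, Nat.cast_zero]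
      rw [Finset.sum_ite_eq S ρ, if_pos hρ, Finset.sum_ite_eq T ρ, if_neg hρT, castpp, mul_zero, add_zero]
      exact hle
    · rw [hΛl l hl, hΛl l hl, Finsupp.single_apply, if_neg (Ne.symm hl), Nat.cast_zero, mul_zero]
      positivity

end Summit.ResolutionOfSingularities.ResolutionOfSingularities.Theorems.WildQuotientResolution.PthCone

end
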